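import Literature.Probability.RandomPlanarGeometry.SAWAllWalksPieceInsertion
import Literature.Probability.RandomPlanarGeometry.SAWRatioRateUpperCubeRoot
import Literature.Probability.RandomPlanarGeometry.SAWHalfSpacePiecesSymmetry
import Literature.Probability.RandomPlanarGeometry.SAWEndpointRateLowerInsertion
import Literature.Probability.RandomPlanarGeometry.SAWPolygonGrowth
import Literature.Probability.RandomPlanarGeometry.SAWPatternTheorem
import Literature.Probability.RandomPlanarGeometry.SAWKestenRatioRate
import Literature.Probability.RandomPlanarGeometry.SAWKestenRatioExplicit
import HarnessLib

/-!
# Kesten's ratio rate `|c_{N+2}/c_N − μ²| ≤ K N^{-1/3}` (Madras–Slade (7.5.1)) in EVERY dimension `d ≥ 2`: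
# the named fact `Zd.Kesten1963_ratioRate` discharged

Topic `Literature/Probability/RandomPlanarGeometry` (assembles `SAWPatternTheorem.lean` + `SAWKestenPatterns.lean` (Theorem 7.3.2(a)
for all walks in every dimension: `patternBound_VQ`, `thm732_of_patternBound`), `SAWAllWalksPieceInsertion.lean` (the
insertion-or-append inequality `PieceInsertionZd.count_mul_le`), `SAWHalfSpacePiecesSymmetry.lean` (half-space pieces vs. walks closing
next to the origin), `SAWPolygonGrowth.lean` (Corollary 3.2.5 in every dimension), `SAWEndpointRateLowerInsertion.lean` (the abstract
lower `1/3`-rate lemma, insertion form), `SAWRatioRateUpperCubeRoot.lean` (the abstract upper `1/3`-rate lemma, submultiplicative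
form), `SAWKestenRatioExplicit.lean` (the Hammersley–Welsh envelope `KestenRate.count_le_envelope`)).

Source: N. Madras, G. Slade, *The Self-Avoiding Walk* (1993), §7.5 Notes, eq. (7.5.1) (p. 255; Kesten 1963; also Grimmett's survey,
Theorem 13(a)): "`|c_{N+2}/c_N − μ²| ≤ K N^{-1/3}` for all sufficiently large `N`".  The tree types this as the NAMED FACT
`Zd.Kesten1963_ratioRate` (`SAWKestenRatioRate.lean`); its planar files prove the weaker rate `K √((G(2N)+1)/N)` (`kestenRatioRateZ2`).
THIS FILE PROVES THE NAMED FACT in every dimension `d ≥ 2` with the printed exponent `1/3` on both sides: the lower side by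
inserting closed loops of length `2M` (counted by `c_{2M−1}(0,−e₂)`, Corollary 3.2.5) into all `N'`-step walks, the upper side by
submultiplicativity `c_{N+2M} ≤ c_N c_{2M}` and the Hammersley–Welsh bound at the short length `2M`.

## What is here (namespace `Literature.Probability.RandomPlanarGeometry.SAW.Zd`; all proved, axioms standard)

* `RatioRateAllDim.thm732a`, `RatioRateAllDim.kesten_ineq_all` — Theorem 7.3.2(a) and (7.3.3) for all `n ≥ 1`, every `ℤ^{d+2}`;
* `RatioRateAllDim.count_mul_countAt_eNeg_le` — the insertion inequality `c_{N'} · c_m(0,−e₂) ≤ 4(d+2)(m+1)(4(d+2)² N' + 2(d+2)) c_{N'+m+1}`;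
* **`Kesten1963_ratioRate_allDim (d)`** — (7.5.1) on `ℤ^{d+2}`; **`Kesten1963_ratioRate_holds : Kesten1963_ratioRate`**.
-/

noncomputable section

open Filter Topology Finset Literature.Probability.LatticeModels SimpleGraph
open scoped BigOperators

namespace Literature.Probability.RandomPlanarGeometry.SAW.Zd

namespace RatioRateAllDim

variable {d : ℕ}

/-! ### Theorem 7.3.2(a) and (7.3.3) for all walks, every dimension -/

/-- **Madras–Slade Theorem 7.3.2(a) in `ℤ^{d+2}`** (the tree's `thm732_of_patternBound` fed with `patternBound_VQ`).
[cite: MadrasSlade1993, Theorem 7.3.2 (a) (p. 244)] -/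
theorem thm732a (d : ℕ) : ∃ D : ℝ, ∀ᶠ N : ℕ in atTop,
    ((count (d + 2) (N + 2) : ℝ) / count (d + 2) N) ^ 2 - D / N ≤
      ((count (d + 2) (N + 2) : ℝ) / count (d + 2) N) * ((count (d + 2) (N + 4) : ℝ) / count (d + 2) (N + 2)) := by
  obtain ⟨a, C, ha, hPT⟩ := patternBound_VQ d
  exact thm732_of_patternBound d ha hPT

/-- **(7.3.3) for `c_n`, all `n ≥ 1`**: `c_{n+2}/c_n − B/n ≤ c_{n+4}/c_{n+2}` with `B ≥ max(1, μ²)` (Theorem 7.3.2(a) eventually, `c_n ≤ c_{n+2}`,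
and a finite maximum over small `n`). [cite: MadrasSlade1993, Lemma 7.3.1 (proof, eq. (7.3.3)); §7.1, eq. (7.1.5)] -/
theorem kesten_ineq_all (d : ℕ) : ∃ B : ℝ, 1 ≤ B ∧ connectiveConstant (d + 2) ^ 2 ≤ B ∧ ∀ n : ℕ, 1 ≤ n →
    (count (d + 2) (n + 2) : ℝ) / count (d + 2) n - B / n ≤ (count (d + 2) (n + 4) : ℝ) / count (d + 2) (n + 2) := by
  classical
  obtain ⟨D, hD⟩ := thm732a d
  obtain ⟨N₁, hN₁⟩ := eventually_atTop.1 hD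
  have ha : ∀ n, (0 : ℝ) < count (d + 2) n := fun n => by exact_mod_cast one_le_count (d + 2) n
  set φ : ℕ → ℝ := fun n => (count (d + 2) (n + 2) : ℝ) / count (d + 2) n with hφ
  have hφpos : ∀ n, 0 < φ n := fun n => div_pos (ha _) (ha _)
  set D' : ℝ := max D 0 with hD'
  set B : ℝ := D' + connectiveConstant (d + 2) ^ 2 + 1 + ∑ n ∈ Finset.range N₁, (n : ℝ) * φ n with hB
  have hsum : 0 ≤ ∑ n ∈ Finset.range N₁, (n : ℝ) * φ n :=
    Finset.sum_nonneg fun n _ => mul_nonneg (Nat.cast_nonneg _) (hφpos n).le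
  have hD'0 : 0 ≤ D' := le_max_right _ _
  have hμ2 : 0 ≤ connectiveConstant (d + 2) ^ 2 := sq_nonneg _
  refine ⟨B, by rw [hB]; linarith, by rw [hB]; linarith, fun n hn => ?_⟩
  have hn0 : (0 : ℝ) < n := by exact_mod_cast hn
  have hB0 : 0 ≤ B := by rw [hB]; linarith
  show φ n - B / n ≤ φ (n + 2)
  rcases le_or_gt N₁ n with hbig | hsmall
  · have h1 : φ n ^ 2 - D / n ≤ φ n * φ (n + 2) := by
      have := hN₁ n hbig
      simpa [hφ, show n + 2 + 2 = n + 4 by ring] using this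
    have hφ1 : 1 ≤ φ n := by
      show (1 : ℝ) ≤ (count (d + 2) (n + 2) : ℝ) / count (d + 2) n
      rw [le_div_iff₀ (ha n), one_mul]
      exact_mod_cast count_le_count_add_two (d + 2) n
    have hDD : D ≤ B := by rw [hB]; linarith [le_max_left D 0]
    have h2 : φ n * (φ n - B / n) ≤ φ n * φ (n + 2) := by
      have h3 : B / n ≤ φ n * (B / n) := le_mul_of_one_le_left (div_nonneg hB0 hn0.le) hφ1
      have h4 : D / n ≤ B / n := div_le_div_of_nonneg_right hDD hn0.le
      nlinarith
    exact le_of_mul_le_mul_left h2 (hφpos n)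
  · have h1 : (n : ℝ) * φ n ≤ B := by
      have : (n : ℝ) * φ n ≤ ∑ m ∈ Finset.range N₁, (m : ℝ) * φ m :=
        Finset.single_le_sum (f := fun m : ℕ => (m : ℝ) * φ m) (fun m _ => mul_nonneg (Nat.cast_nonneg _) (hφpos m).le)
          (Finset.mem_range.2 hsmall)
      rw [hB]; linarith
    have h2 : φ n ≤ B / n := by rw [le_div_iff₀ hn0]; linarith
    linarith [hφpos (n + 2)]

/-! ### The insertion inequality for all walks -/

/-- `−e₂` is a neighbour of the origin. [folklore] -/
private theorem adj_zero_eNeg' : (zdGraph (d + 2)).Adj (0 : Site (d + 2)) eNeg := by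
  rw [zdGraph_adj_iff]
  exact ⟨1, Or.inr (by simp [eNeg])⟩

/-- **Insertion inequality for all walks**: for `N' ≥ 1` and `m ≥ 2`,
`c_{N'} · c_m(0,−e₂) ≤ 4(d+2)(m+1) · (4(d+2)² N' + 2(d+2)) · c_{N'+m+1}` on `ℤ^{d+2}`.
[cite: MadrasSlade1993, §7.5, eq. (7.5.1) (the super-multiplicative input at a short length); Corollary 3.2.6 (proof)] -/
theorem count_mul_countAt_eNeg_le {N' m : ℕ} (hN' : 1 ≤ N') (hm : 2 ≤ m) :
    count (d + 2) N' * countAt (d + 2) m eNeg ≤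
      4 * (d + 2) * (m + 1) * (4 * (d + 2) ^ 2 * N' + 2 * (d + 2)) * count (d + 2) (N' + m + 1) := by
  classical
  set O : Finset ((Fin (d + 2) × Bool) × (Fin (d + 2) × Bool)) := Finset.univ.filter fun o => o.2.1 ≠ o.1.1 with hO
  set sg : Bool → ℤ := fun b => if b then 1 else -1 with hsg
  set f : (Fin (d + 2) × Bool) × (Fin (d + 2) × Bool) → ℕ := fun o =>
    (PieceInsertionZd.pieces m o.1.1 (sg o.1.2) (Pi.single o.2.1 (sg o.2.2))).card with hf
  have hOne : O.Nonempty := ⟨((0, true), (1, true)), by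
    rw [hO, Finset.mem_filter]; exact ⟨Finset.mem_univ _, Fin.ne_of_val_ne (by simp)⟩⟩
  obtain ⟨o₀, ho₀, hmin⟩ := Finset.exists_min_image O f hOne
  have hk₀ : o₀.2.1 ≠ o₀.1.1 := by rw [hO, Finset.mem_filter] at ho₀; exact ho₀.2
  set L := f o₀ with hL
  have hsign : ∀ b : Bool, sg b = 1 ∨ sg b = -1 := fun b => by cases b <;> simp [hsg]
  have hLle : ∀ (k : Fin (d + 2)) (s : ℤ) (k' : Fin (d + 2)) (t : ℤ), k' ≠ k → (s = 1 ∨ s = -1) → (t = 1 ∨ t = -1) →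
      L ≤ (PieceInsertionZd.pieces m k s (Pi.single k' t)).card := by
    intro k s k' t hk' hs ht
    obtain ⟨bs, hbs⟩ : ∃ b : Bool, sg b = s := by
      rcases hs with rfl | rfl
      · exact ⟨true, by simp [hsg]⟩
      · exact ⟨false, by simp [hsg]⟩
    obtain ⟨bt, hbt⟩ : ∃ b : Bool, sg b = t := by
      rcases ht with rfl | rfl
      · exact ⟨true, by simp [hsg]⟩
      · exact ⟨false, by simp [hsg]⟩
    have := hmin ((k, bs), (k', bt)) (by rw [hO, Finset.mem_filter]; exact ⟨Finset.mem_univ _, hk'⟩)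
    rw [hL]
    refine this.trans (le_of_eq ?_)
    simp only [hf, hbs, hbt]
  have hd : ∀ k : Fin (d + 2), ∃ k' : Fin (d + 2), k' ≠ k := fun k => by
    by_cases h : k = 0
    · exact ⟨1, by rw [h]; exact Fin.ne_of_val_ne (by simp)⟩
    · exact ⟨0, fun h' => h h'.symm⟩
  have h1 := PieceInsertionZd.count_mul_le (m := m) hN' hd hLle
  have h2 := HalfSpacePieces.countAt_le_card_halfSpace (m := m) adj_zero_eNeg' hm (k := o₀.1.1) (k' := o₀.2.1) hk₀
    (hsign o₀.1.2) (hsign o₀.2.2)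
  have h2' : countAt (d + 2) m eNeg ≤ 4 * (d + 2) * (m + 1) * L := by rw [hL, hf]; exact h2
  calc count (d + 2) N' * countAt (d + 2) m eNeg ≤ count (d + 2) N' * (4 * (d + 2) * (m + 1) * L) := Nat.mul_le_mul_left _ h2'
    _ = 4 * (d + 2) * (m + 1) * (count (d + 2) N' * L) := by ring
    _ ≤ 4 * (d + 2) * (m + 1) * ((4 * (d + 2) ^ 2 * N' + 2 * (d + 2)) * count (d + 2) (N' + m + 1)) :=
        Nat.mul_le_mul_left _ h1
    _ = 4 * (d + 2) * (m + 1) * (4 * (d + 2) ^ 2 * N' + 2 * (d + 2)) * count (d + 2) (N' + m + 1) := by ring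

/-! ### The two rates and the named fact -/

/-- Elementary: `16 (d+2)(2M) (4(d+2)² N' + 2(d+2)) ≤ 192 (d+2)³ · (2(N'+2M)+3)^6 / …` — we use the crude
`16 · (2M) · (4 N' + 2) ≤ (2(N'+2M)+3)^6`. [folklore] -/
private theorem poly_bound' (N' : ℕ) {M : ℕ} (hM1 : 1 ≤ M) :
    (16 : ℝ) * ((2 * M - 1 : ℕ) + 1) * (4 * (N' : ℝ) + 2) ≤ (2 * ((N' : ℝ) + 2 * M) + 3) ^ 6 := by
  have h1 : (((2 * M - 1 : ℕ) : ℝ) + 1) ≤ 2 * M := by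
    rw [Nat.cast_sub (by omega)]; push_cast; linarith
  have hN : (0 : ℝ) ≤ N' := Nat.cast_nonneg _
  have hM : (0 : ℝ) ≤ M := Nat.cast_nonneg _
  set S : ℝ := 2 * ((N' : ℝ) + 2 * M) + 3 with hS
  have hS3 : 3 ≤ S := by rw [hS]; linarith
  have hNS : 4 * (N' : ℝ) + 2 ≤ 2 * S := by rw [hS]; linarith
  have hMS : 2 * (M : ℝ) ≤ S := by rw [hS]; linarith
  calc (16 : ℝ) * ((2 * M - 1 : ℕ) + 1) * (4 * (N' : ℝ) + 2) ≤ 16 * (2 * M) * (2 * S) := by gcongr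
    _ ≤ 16 * S * (2 * S) := by gcongr
    _ = 32 * S ^ 2 := by ring
    _ ≤ S ^ 4 * S ^ 2 := by
        have h34 : (3 : ℝ) ^ 4 ≤ S ^ 4 := pow_le_pow_left₀ (by norm_num) hS3 4
        have : (32 : ℝ) ≤ S ^ 4 := by norm_num at h34; linarith
        exact mul_le_mul_of_nonneg_right this (sq_nonneg _)
    _ = S ^ 6 := by ring

/-- **Short-length Hammersley–Welsh envelope**: `c_{2M} ≤ μ e^{1+π+log μ} · e^{(4+2π)√M} · μ^{2M}`.
[cite: MadrasSlade1993, Theorem 3.1.1 (Hammersley–Welsh bound)] -/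
theorem count_two_mul_le_envelope (d M : ℕ) : (count (d + 2) (2 * M) : ℝ) ≤
    (connectiveConstant (d + 2) * Real.exp (1 + Real.pi + Real.log (connectiveConstant (d + 2)))) *
      Real.exp ((4 + 2 * Real.pi) * Real.sqrt M) * connectiveConstant (d + 2) ^ (2 * M) := by
  set μ := connectiveConstant (d + 2) with hμdef
  have hμ1 : 1 ≤ μ := one_le_connectiveConstant (d + 2)
  have h := KestenRate.count_le_envelope (d + 2) (2 * M)
  refine h.trans ?_
  rw [← hμdef]
  have hM0 : (0 : ℝ) ≤ M := Nat.cast_nonneg _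
  have hsM : 0 ≤ Real.sqrt M := Real.sqrt_nonneg _
  have hG : KestenRate.hwEnvelope μ (2 * M) ≤ (1 + Real.pi + Real.log μ) + (4 + 2 * Real.pi) * Real.sqrt M := by
    unfold KestenRate.hwEnvelope
    have h1 : Real.log (((2 * M : ℕ) : ℝ) + 1) ≤ 4 * Real.sqrt M := by
      rcases Nat.eq_zero_or_pos M with rfl | hMpos
      · simp
      · have hM1 : (1 : ℝ) ≤ M := by exact_mod_cast hMpos
        have hpos : 0 < Real.sqrt (((2 * M : ℕ) : ℝ) + 1) := Real.sqrt_pos.2 (by positivity)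
        have h2 := Real.log_le_sub_one_of_pos hpos
        rw [Real.log_sqrt (by positivity)] at h2
        have h3 : Real.sqrt (((2 * M : ℕ) : ℝ) + 1) ≤ Real.sqrt 3 * Real.sqrt M := by
          rw [← Real.sqrt_mul (by norm_num)]
          exact Real.sqrt_le_sqrt (by push_cast; linarith)
        have h4 : Real.sqrt 3 ≤ 2 := by
          rw [Real.sqrt_le_left (by norm_num)]; norm_num
        have h5 : Real.sqrt 3 * Real.sqrt M ≤ 2 * Real.sqrt M := mul_le_mul_of_nonneg_right h4 hsM
        linarith
    have h2 : Real.pi * Real.sqrt (2 * (((2 * M : ℕ) : ℝ) + 1) / 3) ≤ Real.pi * (2 * Real.sqrt M + 1) := by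
      apply mul_le_mul_of_nonneg_left _ Real.pi_pos.le
      rw [Real.sqrt_le_left (by positivity)]
      have e : (2 * Real.sqrt (M : ℝ) + 1) ^ 2 = 4 * M + 4 * Real.sqrt M + 1 := by
        rw [add_sq, mul_pow, Real.sq_sqrt hM0]; ring
      rw [e]; push_cast; nlinarith [hsM]
    nlinarith [h1, h2, Real.pi_pos, hsM]
  have hexp : Real.exp (KestenRate.hwEnvelope μ (2 * M)) ≤
      Real.exp (1 + Real.pi + Real.log μ) * Real.exp ((4 + 2 * Real.pi) * Real.sqrt M) := by
    rw [← Real.exp_add]; exact Real.exp_le_exp.2 hG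
  calc Real.exp (KestenRate.hwEnvelope μ (2 * M)) * μ ^ (2 * M)
      ≤ (Real.exp (1 + Real.pi + Real.log μ) * Real.exp ((4 + 2 * Real.pi) * Real.sqrt M)) * μ ^ (2 * M) :=
        mul_le_mul_of_nonneg_right hexp (by positivity)
    _ ≤ (μ * Real.exp (1 + Real.pi + Real.log μ)) * Real.exp ((4 + 2 * Real.pi) * Real.sqrt M) * μ ^ (2 * M) := by
        have : Real.exp (1 + Real.pi + Real.log μ) ≤ μ * Real.exp (1 + Real.pi + Real.log μ) :=
          le_mul_of_one_le_left (Real.exp_pos _).le hμ1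
        gcongr

/-- **Upper rate** `c_{N+2}/c_N − μ² ≤ K N^{-1/3}` on `ℤ^{d+2}` (submultiplicativity at the short length).
[cite: MadrasSlade1993, §7.5, eq. (7.5.1) (upper side, exponent 1/3)] -/
theorem rate_upper (d : ℕ) : ∃ K : ℝ, ∀ N : ℕ, 1 ≤ N → ∀ u : ℝ, 0 < u →
    connectiveConstant (d + 2) ^ 2 + u ≤ (count (d + 2) (N + 2) : ℝ) / count (d + 2) N →
      u ≤ K * (N : ℝ) ^ (-(1 : ℝ) / 3) := by
  set μ := connectiveConstant (d + 2) with hμdef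
  have hμ1 : 1 ≤ μ := one_le_connectiveConstant (d + 2)
  have ha : ∀ n, (0 : ℝ) < count (d + 2) n := fun n => by exact_mod_cast one_le_count (d + 2) n
  obtain ⟨B, hB1, -, hK⟩ := kesten_ineq_all d
  have hsub : ∀ N M : ℕ, (count (d + 2) (N + 2 * M) : ℝ) ≤ count (d + 2) N * count (d + 2) (2 * M) := fun N M => by
    exact_mod_cast count_add_le (d + 2) N (2 * M)
  have hA1 : 1 ≤ μ * Real.exp (1 + Real.pi + Real.log μ) := by
    have hl := Real.log_nonneg hμ1
    have : 1 ≤ Real.exp (1 + Real.pi + Real.log μ) := Real.one_le_exp (by linarith [Real.pi_pos])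
    nlinarith
  exact KestenRateUpper.upper_rate_cubeRoot_sub (a := fun n => (count (d + 2) n : ℝ))
    (a₂ := fun M => (count (d + 2) (2 * M) : ℝ)) ha hμ1 hB1 hA1 hK hsub (count_two_mul_le_envelope d)

/-- **The insertion inequality in the shape of the abstract lower-rate lemma**: with `Dc = 4(d+2)(4(d+2)² + 2(d+2))`,
`c_{N'} · (c_{2M−1}(0,−e₂)/Dc) ≤ (2(N'+2M)+3)⁶ c_{N'+2M}` for `N' ≥ 1`, `M ≥ 2`.
[cite: MadrasSlade1993, §7.5, eq. (7.5.1) (lower side: the super-multiplicative input); Corollary 3.2.6 (proof)] -/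
theorem insertion_hSM (d : ℕ) (N' M : ℕ) (hN' : 1 ≤ N') (hM : 2 ≤ M) :
    (count (d + 2) N' : ℝ) * ((countAt (d + 2) (2 * M - 1) eNeg : ℝ) /
        (4 * ((d : ℝ) + 2) * (4 * ((d : ℝ) + 2) ^ 2 + 2 * ((d : ℝ) + 2)))) ≤
      (2 * ((N' : ℝ) + 2 * M) + 3) ^ 6 * (count (d + 2) (N' + 2 * M) : ℝ) := by
  set Dc : ℝ := 4 * ((d : ℝ) + 2) * (4 * ((d : ℝ) + 2) ^ 2 + 2 * ((d : ℝ) + 2)) with hDc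
  have hd0 : (0 : ℝ) ≤ d := Nat.cast_nonneg d
  have hDc0 : 0 < Dc := by rw [hDc]; positivity
  have h := count_mul_countAt_eNeg_le (d := d) (N' := N') (m := 2 * M - 1) hN' (by omega)
  rw [show N' + (2 * M - 1) + 1 = N' + 2 * M by omega] at h
  have h' : ((count (d + 2) N' * countAt (d + 2) (2 * M - 1) eNeg : ℕ) : ℝ) ≤
      ((4 * (d + 2) * (2 * M - 1 + 1) * (4 * (d + 2) ^ 2 * N' + 2 * (d + 2)) * count (d + 2) (N' + 2 * M) : ℕ) : ℝ) := by
    exact_mod_cast h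
  have hp := poly_bound' N' (M := M) (by omega)
  have hc0 : (0 : ℝ) ≤ count (d + 2) (N' + 2 * M) := Nat.cast_nonneg _
  rw [mul_div_assoc', div_le_iff₀ hDc0]
  push_cast at h'
  have hN'1 : (1 : ℝ) ≤ N' := by exact_mod_cast hN'
  have hm0 : (0 : ℝ) ≤ ((2 * M - 1 : ℕ) : ℝ) + 1 := by positivity
  calc (count (d + 2) N' : ℝ) * countAt (d + 2) (2 * M - 1) eNeg
      ≤ 4 * ((d : ℝ) + 2) * ((2 * M - 1 : ℕ) + 1) * (4 * ((d : ℝ) + 2) ^ 2 * N' + 2 * ((d : ℝ) + 2)) *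
          count (d + 2) (N' + 2 * M) := h'
    _ ≤ Dc * (((2 * M - 1 : ℕ) + 1) * (4 * (N' : ℝ) + 2)) * count (d + 2) (N' + 2 * M) := by
        apply mul_le_mul_of_nonneg_right _ hc0
        rw [hDc]
        nlinarith [mul_nonneg hm0 hd0, mul_nonneg (mul_nonneg hm0 hd0) hd0, mul_nonneg hm0 (by linarith : (0 : ℝ) ≤ N'),
          mul_nonneg (mul_nonneg (mul_nonneg hm0 hd0) hd0) hd0]
    _ ≤ Dc * ((2 * ((N' : ℝ) + 2 * M) + 3) ^ 6 / 16) * count (d + 2) (N' + 2 * M) := by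
        apply mul_le_mul_of_nonneg_right _ hc0
        apply mul_le_mul_of_nonneg_left _ hDc0.le
        rw [le_div_iff₀ (by norm_num)]
        nlinarith [hp]
    _ ≤ (2 * ((N' : ℝ) + 2 * M) + 3) ^ 6 * count (d + 2) (N' + 2 * M) * Dc := by
        have : 0 ≤ (2 * ((N' : ℝ) + 2 * M) + 3) ^ 6 * count (d + 2) (N' + 2 * M) * Dc := by positivity
        nlinarith [this]

/-- **Lower rate** `μ² − c_{N+2}/c_N ≤ K N^{-1/3}` on `ℤ^{d+2}` along a parity class (insertion of closed loops).
[cite: MadrasSlade1993, §7.5, eq. (7.5.1) (lower side, exponent 1/3); Corollary 3.2.5] -/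
theorem rate_lower (d r : ℕ) : ∃ K : ℝ, ∀ N : ℕ, 2 * 1 + 1 ≤ N → N % 2 = r → ∀ u : ℝ, 0 < u →
    (count (d + 2) (N + 2) : ℝ) / count (d + 2) N ≤ connectiveConstant (d + 2) ^ 2 - u →
      u ≤ K * (N : ℝ) ^ (-(1 : ℝ) / 3) := by
  set μ := connectiveConstant (d + 2) with hμdef
  have hμ1 : 1 ≤ μ := one_le_connectiveConstant (d + 2)
  have hμ0 : 0 < μ := by linarith
  have ha : ∀ n, (0 : ℝ) < count (d + 2) n := fun n => by exact_mod_cast one_le_count (d + 2) n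
  obtain ⟨B, hB1, hBμ, hK⟩ := kesten_ineq_all d
  obtain ⟨C, hCenv⟩ := MadrasSlade1993_cor325_lower_general (d := d + 2) (by omega)
  set Dc : ℝ := 4 * ((d : ℝ) + 2) * (4 * ((d : ℝ) + 2) ^ 2 + 2 * ((d : ℝ) + 2)) with hDc
  have hd0 : (0 : ℝ) ≤ d := Nat.cast_nonneg d
  have hDc1 : 1 ≤ Dc := by rw [hDc]; nlinarith
  have hDc0 : 0 < Dc := by linarith
  have hloE : ∀ M : ℕ, 2 ≤ M → Real.exp (-(|C| * Real.sqrt M)) * μ ^ (2 * M) ≤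
      (μ ^ 2 * Dc) * ((countAt (d + 2) (2 * M - 1) eNeg : ℝ) / Dc) := by
    intro M hM
    have h := hCenv (M - 1) (by omega)
    rw [show 2 * (M - 1) + 1 = 2 * M - 1 by omega] at h
    have hs : Real.sqrt ((M - 1 : ℕ) : ℝ) ≤ Real.sqrt M := Real.sqrt_le_sqrt (by exact_mod_cast Nat.sub_le M 1)
    have h1 : Real.exp (-(|C| * Real.sqrt M)) ≤ Real.exp (-(C * Real.sqrt ((M - 1 : ℕ) : ℝ))) := by
      apply Real.exp_le_exp.2
      have : C * Real.sqrt ((M - 1 : ℕ) : ℝ) ≤ |C| * Real.sqrt M :=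
        calc C * Real.sqrt ((M - 1 : ℕ) : ℝ) ≤ |C| * Real.sqrt ((M - 1 : ℕ) : ℝ) :=
              mul_le_mul_of_nonneg_right (le_abs_self C) (Real.sqrt_nonneg _)
          _ ≤ |C| * Real.sqrt M := mul_le_mul_of_nonneg_left hs (abs_nonneg C)
      linarith
    have e : μ ^ (2 * M) = μ ^ 2 * μ ^ (2 * (M - 1)) := by rw [← pow_add]; congr 1; omega
    have eD : (μ ^ 2 * Dc) * ((countAt (d + 2) (2 * M - 1) eNeg : ℝ) / Dc) = μ ^ 2 * (countAt (d + 2) (2 * M - 1) eNeg : ℝ) := by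
      field_simp
    rw [e, eD]
    calc Real.exp (-(|C| * Real.sqrt M)) * (μ ^ 2 * μ ^ (2 * (M - 1)))
        = μ ^ 2 * (μ ^ (2 * (M - 1)) * Real.exp (-(|C| * Real.sqrt M))) := by ring
      _ ≤ μ ^ 2 * (μ ^ (2 * (M - 1)) * Real.exp (-(C * Real.sqrt ((M - 1 : ℕ) : ℝ)))) := by gcongr
      _ ≤ μ ^ 2 * (countAt (d + 2) (2 * M - 1) eNeg : ℝ) := mul_le_mul_of_nonneg_left h (by positivity)
  exact KestenRateLower.lower_rate_cubeRoot_ins (a := fun n => (count (d + 2) n : ℝ))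
    (e := fun M => (countAt (d + 2) (2 * M - 1) eNeg : ℝ) / Dc) (n₁ := 1) (r := r) ha hμ1 hB1 hBμ (abs_nonneg C)
    (by nlinarith : (1 : ℝ) ≤ μ ^ 2 * Dc) hK hloE (fun N' M hN' hpar hM => insertion_hSM d N' M hN' hM)

/-- **Kesten's ratio rate (Madras–Slade (7.5.1)) on `ℤ^{d+2}`**: there are `K`, `N₀` with `|c_{N+2}/c_N − μ²| ≤ K N^{-1/3}` for all
`N ≥ N₀`. [cite: MadrasSlade1993, §7.5 Notes, eq. (7.5.1) (p. 255); Grimmett2021Kesten, §5, Theorem 13(a); Kesten1963SAW] -/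
theorem _root_.Literature.Probability.RandomPlanarGeometry.SAW.Zd.Kesten1963_ratioRate_allDim (d : ℕ) :
    ∃ K : ℝ, ∃ N₀ : ℕ, ∀ N : ℕ, N₀ ≤ N →
      |(count (d + 2) (N + 2) : ℝ) / count (d + 2) N - connectiveConstant (d + 2) ^ 2| ≤ K * (N : ℝ) ^ (-(1 : ℝ) / 3) := by
  set μ := connectiveConstant (d + 2) with hμdef
  obtain ⟨K₂, hK₂⟩ := rate_upper d
  obtain ⟨K₀, hK₀⟩ := rate_lower d 0
  obtain ⟨K₁, hK₁⟩ := rate_lower d 1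
  refine ⟨max (max K₀ K₁) (max K₂ 0), 3, fun N hN => ?_⟩
  have hN1 : 1 ≤ N := by omega
  set r : ℝ := (count (d + 2) (N + 2) : ℝ) / count (d + 2) N with hr
  have hN0 : (0 : ℝ) < N := by exact_mod_cast (show 0 < N by omega)
  have hp3 : 0 ≤ (N : ℝ) ^ (-(1 : ℝ) / 3) := Real.rpow_nonneg hN0.le _
  have hKmax0 : 0 ≤ max (max K₀ K₁) (max K₂ 0) := le_trans (le_max_right _ _) (le_max_right _ _)
  rw [abs_le]
  constructor
  · rcases le_or_gt (μ ^ 2) r with h | h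
    · have : 0 ≤ max (max K₀ K₁) (max K₂ 0) * (N : ℝ) ^ (-(1 : ℝ) / 3) := mul_nonneg hKmax0 hp3
      linarith
    · have hdev : r ≤ μ ^ 2 - (μ ^ 2 - r) := by linarith
      rcases Nat.mod_two_eq_zero_or_one N with hpar | hpar
      · have hu := hK₀ N (by omega) hpar (μ ^ 2 - r) (by linarith) hdev
        have : K₀ * (N : ℝ) ^ (-(1 : ℝ) / 3) ≤ max (max K₀ K₁) (max K₂ 0) * (N : ℝ) ^ (-(1 : ℝ) / 3) :=
          mul_le_mul_of_nonneg_right (le_trans (le_max_left _ _) (le_max_left _ _)) hp3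
        linarith
      · have hu := hK₁ N (by omega) hpar (μ ^ 2 - r) (by linarith) hdev
        have : K₁ * (N : ℝ) ^ (-(1 : ℝ) / 3) ≤ max (max K₀ K₁) (max K₂ 0) * (N : ℝ) ^ (-(1 : ℝ) / 3) :=
          mul_le_mul_of_nonneg_right (le_trans (le_max_right _ _) (le_max_left _ _)) hp3
        linarith
  · rcases le_or_gt r (μ ^ 2) with h | h
    · have : 0 ≤ max (max K₀ K₁) (max K₂ 0) * (N : ℝ) ^ (-(1 : ℝ) / 3) := mul_nonneg hKmax0 hp3
      linarith
    · have hdev : μ ^ 2 + (r - μ ^ 2) ≤ r := by linarith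
      have hu := hK₂ N hN1 (r - μ ^ 2) (by linarith) hdev
      have : K₂ * (N : ℝ) ^ (-(1 : ℝ) / 3) ≤ max (max K₀ K₁) (max K₂ 0) * (N : ℝ) ^ (-(1 : ℝ) / 3) :=
        mul_le_mul_of_nonneg_right (le_trans (le_max_left _ _) (le_max_right _ _)) hp3
      linarith

/-- **The named fact `Zd.Kesten1963_ratioRate` (Madras–Slade (7.5.1), Kesten 1963) is a theorem**: for every `d ≥ 2` there are
`K`, `N₀` with `|c_{N+2}/c_N − μ²| ≤ K N^{-1/3}` for all `N ≥ N₀`.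
[cite: MadrasSlade1993, §7.5 Notes, eq. (7.5.1) (p. 255); Grimmett2021Kesten, §5, Theorem 13(a); Kesten1963SAW] -/
theorem _root_.Literature.Probability.RandomPlanarGeometry.SAW.Zd.Kesten1963_ratioRate_holds : Kesten1963_ratioRate := by
  intro d _ hd
  obtain ⟨d', rfl⟩ : ∃ d', d = d' + 2 := ⟨d - 2, by omega⟩
  exact Kesten1963_ratioRate_allDim d'

/-- The tree's conditional corollary `Kesten1963_ratioRate.tendsto` (Theorem 7.3.4(a) from (7.5.1)), now unconditional.
[cite: MadrasSlade1993, Theorem 7.3.4 (a) (p. 248) and (7.5.1) (p. 255)] -/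
theorem tendsto_count_ratio_two_of_rate (d : ℕ) [NeZero d] (hd : 2 ≤ d) :
    Tendsto (fun N : ℕ => (count d (N + 2) : ℝ) / count d N) atTop (𝓝 (connectiveConstant d ^ 2)) :=
  Kesten1963_ratioRate.tendsto Kesten1963_ratioRate_holds d hd

end RatioRateAllDim

end Literature.Probability.RandomPlanarGeometry.SAW.Zd
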